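import Literature.Computability.MetaComplexity.TwoModuliExpSums

set_option linter.dupNamespace false

/-!
# BilinearCubeSumA (lens 4, g29; kernel step K5 of the (c0) road, the character class `s ≠ 0`) — A BILINEAR PHASE ON A PRODUCT OF TWO CUBES: CAUCHY–SCHWARZ ALONG THE BIPARTITION

Blocker `X = AbsorptionDial.NoPerfectPolyOdd` (item 28487); decomp-qadv lens 4, g29.  The one estimate of (P4) of REFEREE-66v65 that is not a product
formula: a character with a non-zero coefficient on the QUADRATIC coordinate of the column map.  Split the column pool along a bipartition
`ι₁ ⊔ ι₂`; the phase is `F₁(x₁) F₂(x₂) χ_p(x₁ᵀ C x₂)` with `|F₁|, |F₂| ≤ 1` (the additive parts and the two diagonal blocks are absorbed in `F₁, F₂`)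
and `C` the cross block.  Then (Cauchy–Schwarz over `x₂`, expand the square, separation of variables in `x₂`):

  `‖Σ_{x₁,x₂} F₁(x₁)F₂(x₂)χ_p(x₁ᵀCx₂)‖² ≤ 2^{|ι₂|} · Σ_{x₁,x₁′} ‖Σ_{x₂} χ_p((x₁ − x₁′)ᵀ C x₂)‖ ≤ 4^{|ι₂|} · Σ_{x₁,x₁′} cos(π/p)^{wt((x₁−x₁′)ᵀC)}`

(`norm_sq_bilinear_le`, `norm_sq_bilinear_le_cos`; the tree's `norm_cubeSum_le` bounds each inner sum), i.e. in normalised form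
`|Ŝ|² ≤ E_{x₁,x₁′} cos(π/p)^{wt(Cᵀ(x₁−x₁′))}` with `x₁ − x₁′ ∈ {0,±1}^{ι₁}` under EXACTLY the `(¼,½,¼)` product law; and the DISPERSION form
`norm_sq_bilinear_le_of_disperse`: if at most `E` pairs `(x₁,x₁′)` have `wt((x₁−x₁′)ᵀC) < w` then `‖S‖² ≤ 4^{|ι₂|}(E + 4^{|ι₁|} cos(π/p)^w)` —
hypothesis (d2′) of the road.  With `SaturationCriterionA` (counting formula, non-empty-fibre criterion, the `s = 0` classes) this completes the
character-sum side of (P4); what remains there is the assembly and the inputs (d1)/(d2′) (from freeness, resp. the dispersing bipartition / (P7)).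
-/

open Finset Complex ZMod
open scoped ComplexConjugate
open Literature.Computability.MetaComplexity.TwoModuli

namespace Summit.QuantumAdvantage.QuantumAdvantage.Theorems.BilinearCubeSum

variable {p : ℕ} [NeZero p] {ι₁ ι₂ : Type*} [Fintype ι₁] [Fintype ι₂] [DecidableEq ι₁] [DecidableEq ι₂]

/-- the row form of a point of the first cube: `j ↦ Σ_{i : x₁ i} C i j = (x₁ᵀ C)_j` -/
def rowForm (C : ι₁ → ι₂ → ZMod p) (x₁ : ι₁ → Bool) : ι₂ → ZMod p := fun j => ∑ i, if x₁ i then C i j else 0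

/-- the cube phase of a form on the second cube: `Σ_{j : x₂ j} β_j` (so `cubePhase (rowForm C x₁) x₂ = x₁ᵀ C x₂`) -/
def cubePhase (β : ι₂ → ZMod p) (x₂ : ι₂ → Bool) : ZMod p := ∑ j, if x₂ j then β j else 0

omit [NeZero p] [DecidableEq ι₂] in
/-- the cube phase is additive in the form -/
theorem cubePhase_sub (β β' : ι₂ → ZMod p) (x₂ : ι₂ → Bool) :
    cubePhase β x₂ - cubePhase β' x₂ = cubePhase (β - β') x₂ := by
  unfold cubePhase
  rw [← sum_sub_distrib]
  refine sum_congr rfl fun j _ => ?_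
  rw [Pi.sub_apply]
  split_ifs <;> ring

/-- the inner cube sum of a form: `Σ_{x₂} χ_p(Σ_{x₂ j} β_j)` is bounded by `2^{|ι₂|} cos(π/p)^{#supp β}` (the tree's `norm_cubeSum_le` at `N = 1`) -/
theorem norm_cubeSum_le' (β : ι₂ → ZMod p) :
    ‖∑ x₂ : ι₂ → Bool, (stdAddChar (cubePhase β x₂) : ℂ)‖
      ≤ 2 ^ Fintype.card ι₂ * Real.cos (Real.pi / p) ^ (univ.filter fun j => β j ≠ 0).card := by
  have h := norm_cubeSum_le (N := 1) (Nat.coprime_one_right p) β (0 : ZMod 1)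
  simp only [AddChar.map_zero_eq_one, one_pow, mul_one, Nat.cast_one] at h
  exact h

/-- **CAUCHY–SCHWARZ ALONG A BIPARTITION.**  For weights `|F₁|, |F₂| ≤ 1` on the two cubes and a cross block `C`,
`‖Σ_{x₁,x₂} F₁(x₁) F₂(x₂) χ_p(x₁ᵀ C x₂)‖² ≤ 2^{|ι₂|} · Σ_{x₁,x₁′} ‖Σ_{x₂} χ_p((x₁−x₁′)ᵀ C x₂)‖`. -/
theorem norm_sq_bilinear_le (C : ι₁ → ι₂ → ZMod p) (F₁ : (ι₁ → Bool) → ℂ) (F₂ : (ι₂ → Bool) → ℂ)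
    (h₁ : ∀ x, ‖F₁ x‖ ≤ 1) (h₂ : ∀ x, ‖F₂ x‖ ≤ 1) :
    ‖∑ x₁ : ι₁ → Bool, ∑ x₂ : ι₂ → Bool, F₁ x₁ * F₂ x₂ * (stdAddChar (cubePhase (rowForm C x₁) x₂) : ℂ)‖ ^ 2
      ≤ 2 ^ Fintype.card ι₂ * ∑ x₁ : ι₁ → Bool, ∑ x₁' : ι₁ → Bool,
          ‖∑ x₂ : ι₂ → Bool, (stdAddChar (cubePhase (rowForm C x₁ - rowForm C x₁') x₂) : ℂ)‖ := by
  -- the inner sums over the first cube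
  set G : (ι₂ → Bool) → ℂ := fun x₂ => ∑ x₁, F₁ x₁ * (stdAddChar (cubePhase (rowForm C x₁) x₂) : ℂ) with hG
  -- (a) `S = Σ_{x₂} F₂ x₂ · G x₂`
  have hS : (∑ x₁ : ι₁ → Bool, ∑ x₂ : ι₂ → Bool, F₁ x₁ * F₂ x₂ * (stdAddChar (cubePhase (rowForm C x₁) x₂) : ℂ))
      = ∑ x₂, F₂ x₂ * G x₂ := by
    rw [sum_comm]
    refine sum_congr rfl fun x₂ _ => ?_
    rw [hG, mul_sum]
    refine sum_congr rfl fun x₁ _ => ?_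
    ring
  -- (b) `‖S‖ ≤ Σ ‖G‖`
  have hb : ‖∑ x₂, F₂ x₂ * G x₂‖ ≤ ∑ x₂, ‖G x₂‖ := by
    refine (norm_sum_le _ _).trans (sum_le_sum fun x₂ _ => ?_)
    rw [norm_mul]
    calc ‖F₂ x₂‖ * ‖G x₂‖ ≤ 1 * ‖G x₂‖ := mul_le_mul_of_nonneg_right (h₂ x₂) (norm_nonneg _)
      _ = ‖G x₂‖ := one_mul _
  -- (c) Cauchy–Schwarz: `(Σ ‖G‖)² ≤ 2^{|ι₂|} Σ ‖G‖²`
  have hc : (∑ x₂, ‖G x₂‖) ^ 2 ≤ 2 ^ Fintype.card ι₂ * ∑ x₂, ‖G x₂‖ ^ 2 := by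
    have h := sum_mul_sq_le_sq_mul_sq (univ : Finset (ι₂ → Bool)) (fun _ => (1 : ℝ)) (fun x₂ => ‖G x₂‖)
    simp only [one_mul, one_pow, sum_const, card_univ, Fintype.card_fun, Fintype.card_bool, nsmul_eq_mul, mul_one] at h
    calc (∑ x₂, ‖G x₂‖) ^ 2 ≤ ((2 ^ Fintype.card ι₂ : ℕ) : ℝ) * ∑ x₂, ‖G x₂‖ ^ 2 := h
      _ = 2 ^ Fintype.card ι₂ * ∑ x₂, ‖G x₂‖ ^ 2 := by push_cast; ring
  -- (d) expand the square: `Σ ‖G‖² = Σ_{x₁,x₁′} F₁ x₁ conj(F₁ x₁′) Σ_{x₂} χ((x₁−x₁′)ᵀCx₂)`, so `≤ Σ_{x₁,x₁′} ‖Σ_{x₂} χ(…)‖`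
  have hd : ∑ x₂, ‖G x₂‖ ^ 2 ≤ ∑ x₁ : ι₁ → Bool, ∑ x₁' : ι₁ → Bool,
      ‖∑ x₂ : ι₂ → Bool, (stdAddChar (cubePhase (rowForm C x₁ - rowForm C x₁') x₂) : ℂ)‖ := by
    -- the expansion as a complex identity
    have hexp : (((∑ x₂, ‖G x₂‖ ^ 2 : ℝ)) : ℂ) = ∑ x₁ : ι₁ → Bool, ∑ x₁' : ι₁ → Bool,
        F₁ x₁ * conj (F₁ x₁') * ∑ x₂ : ι₂ → Bool, (stdAddChar (cubePhase (rowForm C x₁ - rowForm C x₁') x₂) : ℂ) := by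
      push_cast
      have hsq : ∀ x₂, ((‖G x₂‖ : ℝ) : ℂ) ^ 2 = G x₂ * conj (G x₂) := by
        intro x₂
        rw [Complex.mul_conj, Complex.normSq_eq_norm_sq]
        norm_cast
      simp_rw [hsq]
      -- expand `G · conj G` for each `x₂`
      have hterm : ∀ x₂, G x₂ * conj (G x₂) = ∑ x₁ : ι₁ → Bool, ∑ x₁' : ι₁ → Bool,
          F₁ x₁ * conj (F₁ x₁') * (stdAddChar (cubePhase (rowForm C x₁ - rowForm C x₁') x₂) : ℂ) := by
        intro x₂
        rw [hG]
        simp only [map_sum, map_mul]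
        rw [sum_mul_sum]
        refine sum_congr rfl fun x₁ _ => sum_congr rfl fun x₁' _ => ?_
        rw [Literature.Analysis.Fourier.conj_stdAddChar, ← cubePhase_sub, sub_eq_add_neg, AddChar.map_add_eq_mul]
        ring
      simp_rw [hterm]
      rw [sum_comm]
      refine sum_congr rfl fun x₁ _ => ?_
      rw [sum_comm]
      refine sum_congr rfl fun x₁' _ => ?_
      rw [mul_sum]
    have hreal : ∑ x₂, ‖G x₂‖ ^ 2 = ‖(((∑ x₂, ‖G x₂‖ ^ 2 : ℝ)) : ℂ)‖ := by
      rw [Complex.norm_real, Real.norm_eq_abs, abs_of_nonneg (sum_nonneg fun x₂ _ => sq_nonneg _)]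
    rw [hreal, hexp]
    refine (norm_sum_le _ _).trans (sum_le_sum fun x₁ _ => (norm_sum_le _ _).trans (sum_le_sum fun x₁' _ => ?_))
    rw [norm_mul, norm_mul, Complex.norm_conj]
    calc ‖F₁ x₁‖ * ‖F₁ x₁'‖ * ‖∑ x₂ : ι₂ → Bool, (stdAddChar (cubePhase (rowForm C x₁ - rowForm C x₁') x₂) : ℂ)‖
        ≤ 1 * 1 * ‖∑ x₂ : ι₂ → Bool, (stdAddChar (cubePhase (rowForm C x₁ - rowForm C x₁') x₂) : ℂ)‖ :=
          mul_le_mul_of_nonneg_right (mul_le_mul (h₁ x₁) (h₁ x₁') (norm_nonneg _) zero_le_one) (norm_nonneg _)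
      _ = _ := by rw [one_mul, one_mul]
  -- (e) combine
  rw [hS]
  calc ‖∑ x₂, F₂ x₂ * G x₂‖ ^ 2 ≤ (∑ x₂, ‖G x₂‖) ^ 2 := pow_le_pow_left₀ (norm_nonneg _) hb 2
    _ ≤ 2 ^ Fintype.card ι₂ * ∑ x₂, ‖G x₂‖ ^ 2 := hc
    _ ≤ 2 ^ Fintype.card ι₂ * ∑ x₁ : ι₁ → Bool, ∑ x₁' : ι₁ → Bool,
          ‖∑ x₂ : ι₂ → Bool, (stdAddChar (cubePhase (rowForm C x₁ - rowForm C x₁') x₂) : ℂ)‖ :=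
        mul_le_mul_of_nonneg_left hd (by positivity)

/-- **THE `(¼,½,¼)` LAW.**  `‖Σ_{x₁,x₂} F₁ F₂ χ_p(x₁ᵀCx₂)‖² ≤ 4^{|ι₂|} · Σ_{x₁,x₁′} cos(π/p)^{wt((x₁−x₁′)ᵀ C)}` — normalised:
`|Ŝ|² ≤ E_{x₁,x₁′} cos(π/p)^{wt(Cᵀ(x₁−x₁′))}`, `x₁ − x₁′ ∈ {0,±1}^{ι₁}` with the product law `(¼,½,¼)`. -/
theorem norm_sq_bilinear_le_cos (C : ι₁ → ι₂ → ZMod p) (F₁ : (ι₁ → Bool) → ℂ) (F₂ : (ι₂ → Bool) → ℂ)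
    (h₁ : ∀ x, ‖F₁ x‖ ≤ 1) (h₂ : ∀ x, ‖F₂ x‖ ≤ 1) :
    ‖∑ x₁ : ι₁ → Bool, ∑ x₂ : ι₂ → Bool, F₁ x₁ * F₂ x₂ * (stdAddChar (cubePhase (rowForm C x₁) x₂) : ℂ)‖ ^ 2
      ≤ 4 ^ Fintype.card ι₂ * ∑ x₁ : ι₁ → Bool, ∑ x₁' : ι₁ → Bool,
          Real.cos (Real.pi / p) ^ (univ.filter fun j => (rowForm C x₁ - rowForm C x₁') j ≠ 0).card := by
  refine (norm_sq_bilinear_le C F₁ F₂ h₁ h₂).trans ?_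
  calc (2 : ℝ) ^ Fintype.card ι₂ * ∑ x₁ : ι₁ → Bool, ∑ x₁' : ι₁ → Bool,
          ‖∑ x₂ : ι₂ → Bool, (stdAddChar (cubePhase (rowForm C x₁ - rowForm C x₁') x₂) : ℂ)‖
      ≤ 2 ^ Fintype.card ι₂ * ∑ x₁ : ι₁ → Bool, ∑ x₁' : ι₁ → Bool,
          (2 ^ Fintype.card ι₂ * Real.cos (Real.pi / p) ^ (univ.filter fun j => (rowForm C x₁ - rowForm C x₁') j ≠ 0).card) := by
        gcongr with x₁ _ x₁' _
        exact norm_cubeSum_le' _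
    _ = 4 ^ Fintype.card ι₂ * ∑ x₁ : ι₁ → Bool, ∑ x₁' : ι₁ → Bool,
          Real.cos (Real.pi / p) ^ (univ.filter fun j => (rowForm C x₁ - rowForm C x₁') j ≠ 0).card := by
        simp_rw [← mul_sum]
        rw [← mul_assoc, ← mul_pow]
        norm_num

/-- **THE DISPERSION FORM (hypothesis (d2′) of the road).**  If at most `E` ordered pairs `(x₁, x₁′)` of the first cube have
`wt((x₁ − x₁′)ᵀ C) < w`, then `‖Σ_{x₁,x₂} F₁ F₂ χ_p(x₁ᵀCx₂)‖² ≤ 4^{|ι₂|} · (E + 4^{|ι₁|} cos(π/p)^w)`. -/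
theorem norm_sq_bilinear_le_of_disperse (C : ι₁ → ι₂ → ZMod p) (F₁ : (ι₁ → Bool) → ℂ) (F₂ : (ι₂ → Bool) → ℂ)
    (h₁ : ∀ x, ‖F₁ x‖ ≤ 1) (h₂ : ∀ x, ‖F₂ x‖ ≤ 1) (hp2 : 2 ≤ p) (w E : ℕ)
    (hdisp : (univ.filter fun xx : (ι₁ → Bool) × (ι₁ → Bool) =>
        (univ.filter fun j => (rowForm C xx.1 - rowForm C xx.2) j ≠ 0).card < w).card ≤ E) :
    ‖∑ x₁ : ι₁ → Bool, ∑ x₂ : ι₂ → Bool, F₁ x₁ * F₂ x₂ * (stdAddChar (cubePhase (rowForm C x₁) x₂) : ℂ)‖ ^ 2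
      ≤ 4 ^ Fintype.card ι₂ * (E + 4 ^ Fintype.card ι₁ * Real.cos (Real.pi / p) ^ w) := by
  refine (norm_sq_bilinear_le_cos C F₁ F₂ h₁ h₂).trans (mul_le_mul_of_nonneg_left ?_ (by positivity))
  have hp2' : (2 : ℝ) ≤ p := by exact_mod_cast hp2
  have hcos0 : 0 ≤ Real.cos (Real.pi / p) := by
    apply Real.cos_nonneg_of_neg_pi_div_two_le_of_le
    · have : 0 ≤ Real.pi / p := by positivity
      linarith [Real.pi_pos]
    · exact div_le_div_of_nonneg_left Real.pi_pos.le (by norm_num) hp2'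
  have h4 : (4 : ℝ) ^ Fintype.card ι₁ = 2 ^ Fintype.card ι₁ * 2 ^ Fintype.card ι₁ := by
    rw [← mul_pow]; norm_num
  rw [h4]
  have hcos1 : Real.cos (Real.pi / p) ≤ 1 := Real.cos_le_one _
  -- pass to the sum over ordered pairs and bound each term by `[wt < w] + cos^w`
  rw [← Fintype.sum_prod_type']
  set bad : Finset ((ι₁ → Bool) × (ι₁ → Bool)) := univ.filter fun xx =>
      (univ.filter fun j => (rowForm C xx.1 - rowForm C xx.2) j ≠ 0).card < w with hbad
  have hterm : ∀ xx : (ι₁ → Bool) × (ι₁ → Bool),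
      Real.cos (Real.pi / p) ^ (univ.filter fun j => (rowForm C xx.1 - rowForm C xx.2) j ≠ 0).card
        ≤ (if xx ∈ bad then (1 : ℝ) else 0) + Real.cos (Real.pi / p) ^ w := by
    intro xx
    by_cases hx : xx ∈ bad
    · rw [if_pos hx]
      have : Real.cos (Real.pi / p) ^ (univ.filter fun j => (rowForm C xx.1 - rowForm C xx.2) j ≠ 0).card ≤ 1 :=
        pow_le_one₀ hcos0 hcos1
      linarith [pow_nonneg hcos0 w]
    · rw [if_neg hx, zero_add]
      have hw : w ≤ (univ.filter fun j => (rowForm C xx.1 - rowForm C xx.2) j ≠ 0).card := by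
        rw [hbad, mem_filter] at hx
        push Not at hx
        exact hx (mem_univ _)
      exact pow_le_pow_of_le_one hcos0 hcos1 hw
  calc ∑ xx : (ι₁ → Bool) × (ι₁ → Bool), Real.cos (Real.pi / p) ^ (univ.filter fun j => (rowForm C xx.1 - rowForm C xx.2) j ≠ 0).card
      ≤ ∑ xx : (ι₁ → Bool) × (ι₁ → Bool), ((if xx ∈ bad then (1 : ℝ) else 0) + Real.cos (Real.pi / p) ^ w) := sum_le_sum fun xx _ => hterm xx
    _ = bad.card + 2 ^ Fintype.card ι₁ * 2 ^ Fintype.card ι₁ * Real.cos (Real.pi / p) ^ w := by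
        rw [sum_add_distrib, sum_ite_mem, univ_inter, sum_const, nsmul_eq_mul, mul_one, sum_const, card_univ,
          Fintype.card_prod, Fintype.card_fun, Fintype.card_bool, nsmul_eq_mul]
        push_cast
        ring
    _ ≤ E + 2 ^ Fintype.card ι₁ * 2 ^ Fintype.card ι₁ * Real.cos (Real.pi / p) ^ w := by
        have : (bad.card : ℝ) ≤ E := by exact_mod_cast hdisp
        linarith

end Summit.QuantumAdvantage.QuantumAdvantage.Theorems.BilinearCubeSum
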